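import Summits.SmoothPoincare4.SmoothPoincare4.Theorems.ConvexBisectionAcyclicBisectionExistsDualPresentationSeam
import Literature.Topology.FourManifolds.HandleAttachingMapsTransport
import HarnessLib

/-!
# Dual handles, T3 assembly glue: the tube computation, the shallow seam clause, the `τ`-bridge
(sub-goal of stub `stub_T3_dualPresentation` (T3), line `modp-braid-orbits` r12, crux
`ConvexBisection.AcyclicBisectionExists`, item stmt-SmoothPoincare4-10508; wave 5, lead c5, worker X2;
registered sub-goal `helper_lamSq_le_of_dualMap_apply_eq_incl`)

Sequel of `…DualPresentationSeam.lean`; the three pieces of glue used by the T3 contract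
`T3_of_pieces` (`…T3Assembly.lean`):
* `lamSq_le_of_dualMap_apply_eq_incl` (registered): if a dual attaching map takes an old-seam value over
  a base point whose attaching-tube preimages are in Y5's unmoved zone `‖t_λ‖² ≤ 1 - 3κ²/4`, then its
  tube coordinate has `lamSq ≤ 1/4` (`1 - lamSq t = κ² ‖y_μ‖²`, Kosinski's gluing relation);
* `seam_clause_shallow`: THE SEAM CLAUSE of the dual presentation in the shallow form consumed by the
  seam page function (X5) and the binding clause (X6), from the export clause (E1) of the dual data
  (X1) "`jW₂ (D₂.jA w) = j_N w` whenever all dual-tube coordinates of `w` have `lamSq ≤ 1/4`";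
* `mem_coresComplement_of_transport_invol`: for `h₂ j = (q₂ j).transport τ` with `τ` an involution of
  the base, `τ` exchanges the two cores-complements (the bridge to X4's sign pin).

Everything here is proved; no named facts, no `sorry`.

## References
* J. Milnor, *Lectures on the h-cobordism theorem* (1965), §3. [MilnorHCobordism1965]
* A. Kosinski, *Differential Manifolds* (1993), VI §6. [Kosinski1993]
-/

noncomputable section

-- the prescribed namespace `Summit.<P>.<Sub>.…` duplicates `SmoothPoincare4` (P = Sub)
set_option linter.dupNamespace false

open scoped Manifold ContDiff Topology

namespace Summit.SmoothPoincare4.SmoothPoincare4.Theorems.AcyclicBisectionExists.ModpBraidOrbits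

open Set Function Metric Filter Topology
open Literature.Topology.FourManifolds Literature.Topology.FourManifolds.HandleAttachingMap
  Literature.Topology.FourManifolds.LefschetzBase

/-! ### §1 Glue: the tube computation, the shallow seam clause, the `τ`-bridge -/

section Glue

variable {B : Type} [TopologicalSpace B] [T2Space B] [ChartedSpace (EuclideanHalfSpace 4) B]
  {ι : Type} [Finite ι] {h : ι → HandleAttachingMap 3 2 B}
  {X : Type} [TopologicalSpace X] [ChartedSpace (EuclideanHalfSpace 4) X] [IsManifold (𝓡∂ 4) ∞ X]
  {W : Type} [TopologicalSpace W] [ChartedSpace (EuclideanHalfSpace 4) W] [IsManifold (𝓡∂ 4) ∞ W]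

/-- **The tube computation behind the seam clause.**  If a dual attaching map takes the old-seam
value `bW.incl (Ψ z)` at `y`, over a base point `a` (`D.jA a = bX.incl z`) all of whose preimages under
the attaching map `h j` have `‖t_λ‖² ≤ 1 - 3κ²/4` (Y5's unmoved zone), then `lamSq y ≤ 1/4`: indeed `y`
lies on the sphere, the value is `Ψ` of the belt-tube point `D.jB j (σ (θ, κ y_μ, 0))`, which is glued to
`h j (t)` with `1 - lamSq t = κ² ‖y_μ‖²`, so `‖y_μ‖² ≥ 3/4`. [cite: Kosinski1993, VI §6] -/
theorem lamSq_le_of_dualMap_apply_eq_incl (D : MultiAttachmentData h (𝓡∂ 4) X)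
    (bX : BoundaryData (𝓡∂ 4) X (𝓡 3)) (bW : BoundaryData (𝓡∂ 4) W (𝓡 3))
    (Ψ : bX.carrier ≃ₘ⟮𝓡 3, 𝓡 3⟯ bW.carrier) (col : (BoundaryManifold.boundaryData 3 W).Collar) (κ δ : ℝ)
    (hκ : 0 < κ) (hκ1 : κ ≤ 1) (hδ : 0 < δ) (hδ2 : δ ≤ 1 / 2) (j : ι) (y : ↥(handleTube 3 2)) (z : bX.carrier)
    (a : ↥(coresComplement h)) (hz : D.jA a = bX.incl z)
    (hsh : ∀ t : ↥(handleTube 3 2), (h j).toFun t = (a : B) →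
      ‖lamPart ((t : closedBall (0 : EuclideanSpace ℝ (Fin 4)) 1) : EuclideanSpace ℝ (Fin 4))‖ ^ 2 ≤
        1 - 3 * κ ^ 2 / 4)
    (heq : (dualMap D bX bW Ψ col κ δ hκ hκ1 hδ hδ2 j).toFun y = bW.incl (Ψ z)) :
    lamSq 2 ((y : closedBall (0 : EuclideanSpace ℝ (Fin 4)) 1) : EuclideanSpace ℝ (Fin 4)) ≤ 1 / 4 := by
  let A := pushedTubeData (beltMap D j) (seamDiffeo bX bW Ψ) col κ δ hκ hκ1 hδ hδ2
  have hfun : (dualMap D bX bW Ψ col κ δ hκ hκ1 hδ hδ2 j).toFun = A.map := rfl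
  have hbd : (dualMap D bX bW Ψ col κ δ hκ hκ1 hδ hδ2 j).toFun y ∈ (𝓡∂ 4).boundary W := by
    rw [heq]; exact bW.incl_mem_boundary _
  have hy1 : ‖tubeVec y‖ = 1 := ((dualMap D bX bW Ψ col κ δ hκ hκ1 hδ hδ2 j).apply_mem_boundary_iff y).1 hbd
  rw [hfun, A.map_of_norm_eq_one hy1] at heq
  have hlift : A.liftFst y =
      seamDiffeo bX bW Ψ ((beltMap D j).boundaryTube.toHomeo (tubeAngle y, κ • tubeFibre y)) := by
    show ((beltMap D j).boundaryTube.mapDiffeo (seamDiffeo bX bW Ψ)).toHomeo (tubeAngle y, κ • tubeFibre y) = _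
    rw [CircleTube.mapDiffeo_apply]; rfl
  rw [hlift, coe_seamDiffeo] at heq
  have hRz := Ψ.injective (bW.injective_incl heq)
  have hpX : bX.incl z =
      (((beltMap D j).boundaryTube.toHomeo (tubeAngle y, κ • tubeFibre y) : ↥((𝓡∂ 4).boundary X)) : X) := by
    rw [← hRz, incl_restrict_refl]; rfl
  have hpB : (((beltMap D j).boundaryTube.toHomeo (tubeAngle y, κ • tubeFibre y) : ↥((𝓡∂ 4).boundary X)) : X) =
      D.jB j (swapTube (depthLine (tubeAngle y) (κ • tubeFibre y) 0)) :=
    (beltMap D j).coe_boundaryTube_apply _ _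
  -- Kosinski's gluing relation: the belt-tube point is `α t` with `a = h j t`
  obtain ⟨t, ht1, hb, hat⟩ := (D.glue j a _).1 ((hz.trans hpX).trans hpB)
  -- the norms
  have hv : ‖κ • tubeFibre y‖ < κ := A.norm_smul_tubeFibre_lt y
  have hpos : 0 < 1 - 0 - ‖κ • tubeFibre y‖ ^ 2 := by
    have h1 : ‖κ • tubeFibre y‖ < 1 := hv.trans_le hκ1
    have h2 : 0 ≤ ‖κ • tubeFibre y‖ := norm_nonneg _
    nlinarith
  have hlamb : lamSq 2 (((swapTube (depthLine (tubeAngle y) (κ • tubeFibre y) 0) : ↥(beltPiece 3 2)) :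
      closedBall (0 : EuclideanSpace ℝ (Fin 4)) 1) : EuclideanSpace ℝ (Fin 4)) = κ ^ 2 * ‖tubeFibre y‖ ^ 2 := by
    rw [coe_coe_swapTube, lamSq_swapIso, ← tubeVec_mk, tubeVec_depthLine _ _ le_rfl hpos, ← norm_muPart_sq,
      muPart_mkVec, norm_smul, Real.norm_eq_abs, abs_of_pos hκ]
    ring
  have ht0 : 0 < lamSq 2 ((t : closedBall (0 : EuclideanSpace ℝ (Fin 4)) 1) : EuclideanSpace ℝ (Fin 4)) :=
    lamSq_tubeVec_pos t
  have ht1' : lamSq 2 ((t : closedBall (0 : EuclideanSpace ℝ (Fin 4)) 1) : EuclideanSpace ℝ (Fin 4)) ≤ 1 := by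
    have := lamSq_add_muSq 2 ((t : closedBall (0 : EuclideanSpace ℝ (Fin 4)) 1) : EuclideanSpace ℝ (Fin 4))
    have hn : ‖((t : closedBall (0 : EuclideanSpace ℝ (Fin 4)) 1) : EuclideanSpace ℝ (Fin 4))‖ ≤ 1 :=
      mem_closedBall_zero_iff.1 (t : closedBall (0 : EuclideanSpace ℝ (Fin 4)) 1).2
    have hμ : 0 ≤ muSq 2 ((t : closedBall (0 : EuclideanSpace ℝ (Fin 4)) 1) : EuclideanSpace ℝ (Fin 4)) := by
      rw [← norm_muPart_sq]; positivity
    have hn2 : ‖((t : closedBall (0 : EuclideanSpace ℝ (Fin 4)) 1) : EuclideanSpace ℝ (Fin 4))‖ ^ 2 ≤ 1 := by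
      nlinarith [norm_nonneg ((t : closedBall (0 : EuclideanSpace ℝ (Fin 4)) 1) : EuclideanSpace ℝ (Fin 4))]
    linarith
  have hinv := lamSq_handleInversion ht0 ht1'
  rw [← hb, hlamb] at hinv
  -- the shallow hypothesis at `t`
  have hsht := hsh t hat.symm
  rw [norm_lamPart_sq] at hsht
  -- `‖y‖ = 1`: `lamSq y = 1 - ‖y_μ‖²`
  have hsum := lamSq_add_muSq 2 ((y : closedBall (0 : EuclideanSpace ℝ (Fin 4)) 1) : EuclideanSpace ℝ (Fin 4))
  rw [← norm_muPart_sq] at hsum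
  have hy1' : ‖((y : closedBall (0 : EuclideanSpace ℝ (Fin 4)) 1) : EuclideanSpace ℝ (Fin 4))‖ = 1 := hy1
  have hfib : tubeFibre y = muPart ((y : closedBall (0 : EuclideanSpace ℝ (Fin 4)) 1) : EuclideanSpace ℝ (Fin 4)) := rfl
  rw [hfib] at hinv
  rw [hy1', one_pow] at hsum
  have hκsq : 0 < κ ^ 2 := by positivity
  have h34 : κ ^ 2 * (3 / 4) ≤ κ ^ 2 * ‖muPart ((y : closedBall (0 : EuclideanSpace ℝ (Fin 4)) 1) :
      EuclideanSpace ℝ (Fin 4))‖ ^ 2 := by linarith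
  have h34' := le_of_mul_le_mul_left h34 hκsq
  linarith

/-- **THE SEAM CLAUSE, shallow form** (the form consumed by X5's seam page function and X6's binding
clause).  As `seam_clause_of_exports`, but over every base point `a` whose suffix-tube preimages are in
Y5's unmoved zone `‖t_λ‖² ≤ 1 - 3κ²/4` (not only off the suffix ranges), using the export clause (E1) of
the dual data in X1's form "`jW₂ (D₂.jA w) = j_N w` whenever all dual-tube coordinates of `w` have
`lamSq ≤ 1/4`" and the tube computation `lamSq_le_of_dualMap_apply_eq_incl`.
[cite: MilnorHCobordism1965, §3] -/
theorem seam_clause_shallow [IsManifold (𝓡∂ 4) ∞ B] [T2Space W] (m n : ℕ) {k : ℕ} (hk : k = m + n)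
    {h : Fin k → HandleAttachingMap 3 2 B} (D : MultiAttachmentData h (𝓡∂ 4) X)
    {X₁ : Type} [TopologicalSpace X₁] [T2Space X₁] [ChartedSpace (EuclideanHalfSpace 4) X₁]
    [IsManifold (𝓡∂ 4) ∞ X₁]
    (D₁ : MultiAttachmentData (fun i : Fin m => h (Fin.cast hk.symm (Fin.castAdd n i))) (𝓡∂ 4) X₁)
    (D₂' : MultiAttachmentData
      (fun j : Fin n => D₁.lift (h (Fin.cast hk.symm (Fin.natAdd m j))) (disjoint_range_natAdd_castAdd hk D j))
      (𝓡∂ 4) X)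
    (hA : ∀ (a : ↥(coresComplement h))
      (ha₁ : (a : B) ∈ coresComplement fun i : Fin m => h (Fin.cast hk.symm (Fin.castAdd n i)))
      (ha₂ : D₁.jA ⟨a, ha₁⟩ ∈ coresComplement fun j : Fin n =>
        D₁.lift (h (Fin.cast hk.symm (Fin.natAdd m j))) (disjoint_range_natAdd_castAdd hk D j)),
      D₂'.jA ⟨D₁.jA ⟨a, ha₁⟩, ha₂⟩ = D.jA a)
    {bX : BoundaryData (𝓡∂ 4) X (𝓡 3)} {bW : BoundaryData (𝓡∂ 4) W (𝓡 3)} [Nonempty bX.carrier]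
    (G : BoundaryGlueData bX bW) (col : (BoundaryManifold.boundaryData 3 W).Collar)
    (κ δ : ℝ) (hκ : 0 < κ) (hκ1 : κ ≤ 1) (hδ : 0 < δ) (hδ2 : δ ≤ 1 / 2)
    (jX₁ : X₁ → G.d₂.Glued)
    (hYa : ∀ (p : X₁) (hp : p ∈ coresComplement fun j : Fin n =>
        D₁.lift (h (Fin.cast hk.symm (Fin.natAdd m j))) (disjoint_range_natAdd_castAdd hk D j)),
      (∀ (j : Fin n) (t : ↥(handleTube 3 2)),
        (D₁.lift (h (Fin.cast hk.symm (Fin.natAdd m j))) (disjoint_range_natAdd_castAdd hk D j)).toFun t = p →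
        ‖lamPart (t : EuclideanSpace ℝ (Fin 4))‖ ^ 2 ≤ 1 - 3 * κ ^ 2 / 4) →
      jX₁ p = G.jM (D₂'.jA ⟨p, hp⟩))
    {W₂ : Type} [TopologicalSpace W₂] [ChartedSpace (EuclideanHalfSpace 4) W₂]
    (b₂ : BoundaryData (𝓡∂ 4) W₂ (𝓡 3)) (jW₂ : W₂ → G.d₂.Glued) (hinj : Injective jW₂)
    (φ : (BoundaryManifold.boundaryData 3 X₁).carrier ≃ₘ⟮𝓡 3, 𝓡 3⟯ b₂.carrier)
    (hseamId : ∀ z, jW₂ (b₂.incl (φ z)) = jX₁ ((BoundaryManifold.boundaryData 3 X₁).incl z))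
    (D₂ : MultiAttachmentData
      (fun j : Fin n => dualMap D bX bW G.φ col κ δ hκ hκ1 hδ hδ2 (Fin.cast hk.symm (Fin.natAdd m j))) (𝓡∂ 4) W₂)
    (hE1 : ∀ w : ↥(coresComplement
        fun j : Fin n => dualMap D bX bW G.φ col κ δ hκ hκ1 hδ hδ2 (Fin.cast hk.symm (Fin.natAdd m j))),
      (∀ (j : Fin n) (y : ↥(handleTube 3 2)),
        (dualMap D bX bW G.φ col κ δ hκ hκ1 hδ hδ2 (Fin.cast hk.symm (Fin.natAdd m j))).toFun y = (w : W) →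
        lamSq 2 ((y : closedBall (0 : EuclideanSpace ℝ (Fin 4)) 1) : EuclideanSpace ℝ (Fin 4)) ≤ 1 / 4) →
      jW₂ (D₂.jA w) = G.jN w)
    (y : (BoundaryManifold.boundaryData 3 X₁).carrier) (a : ↥(coresComplement h))
    (ha₁ : (a : B) ∈ coresComplement fun i : Fin m => h (Fin.cast hk.symm (Fin.castAdd n i)))
    (z : bX.carrier) (hz : D.jA a = bX.incl z)
    (hy : (BoundaryManifold.boundaryData 3 X₁).incl y = D₁.jA ⟨a, ha₁⟩)
    (hsh : ∀ (j : Fin n) (t : ↥(handleTube 3 2)), (h (Fin.cast hk.symm (Fin.natAdd m j))).toFun t = (a : B) →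
      ‖lamPart ((t : closedBall (0 : EuclideanSpace ℝ (Fin 4)) 1) : EuclideanSpace ℝ (Fin 4))‖ ^ 2 ≤
        1 - 3 * κ ^ 2 / 4) :
    b₂.incl (φ y) = D₂.jA ⟨bW.incl (G.φ z), incl_mem_coresComplement_dualMap D bX bW G.φ col κ δ hκ hκ1 hδ hδ2
      (fun j : Fin n => Fin.cast hk.symm (Fin.natAdd m j)) z a hz⟩ := by
  apply hinj
  -- `D₁.jA a` is off the lifted suffix cores (cores are cores of `h`, and `a` is off all of them)
  have ha₂ : D₁.jA ⟨a, ha₁⟩ ∈ coresComplement fun j : Fin n =>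
      D₁.lift (h (Fin.cast hk.symm (Fin.natAdd m j))) (disjoint_range_natAdd_castAdd hk D j) := by
    rw [mem_coresComplement]
    intro j hj
    rw [MultiAttachmentData.jA_mem_core_lift_iff] at hj
    exact (mem_coresComplement h).1 a.2 _ hj
  -- the shallow condition transfers to the lifted maps (`lift = D₁.jA ∘ h̄`, `D₁.jA` injective)
  have hshl : ∀ (j : Fin n) (t : ↥(handleTube 3 2)),
      (D₁.lift (h (Fin.cast hk.symm (Fin.natAdd m j))) (disjoint_range_natAdd_castAdd hk D j)).toFun t =
        D₁.jA ⟨a, ha₁⟩ → ‖lamPart (t : EuclideanSpace ℝ (Fin 4))‖ ^ 2 ≤ 1 - 3 * κ ^ 2 / 4 := by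
    intro j t ht
    rw [MultiAttachmentData.lift_apply] at ht
    exact hsh j t (congrArg Subtype.val (D₁.injective_jA ht))
  -- (E1) applies at the old-seam point: all its dual-tube coordinates have `lamSq ≤ 1/4`
  have hE : jW₂ (D₂.jA ⟨bW.incl (G.φ z), incl_mem_coresComplement_dualMap D bX bW G.φ col κ δ hκ hκ1 hδ hδ2
      (fun j : Fin n => Fin.cast hk.symm (Fin.natAdd m j)) z a hz⟩) = G.jN (bW.incl (G.φ z)) :=
    hE1 _ fun j y' hy' => lamSq_le_of_dualMap_apply_eq_incl D bX bW G.φ col κ δ hκ hκ1 hδ hδ2 _ y' z a hz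
      (hsh j) hy'
  rw [hseamId, hy, hYa _ ha₂ hshl, hA a ha₁ ha₂, hz, G.jM_incl, hE, G.jN_incl, Diffeomorph.symm_apply_apply]

/-- **The `τ`-bridge**: if `h₂ j = (q₂ j).transport τ` for an involution `τ` of the base, then `τ` maps
the complement of the `h₂`-cores onto the complement of the `q₂`-cores and back. [folklore] -/
theorem mem_coresComplement_of_transport_invol [IsManifold (𝓡∂ 4) ∞ B] {ι₂ : Type} [Finite ι₂]
    {q₂ h₂ : ι₂ → HandleAttachingMap 3 2 B}
    (τ : B ≃ₘ⟮𝓡∂ 4, 𝓡∂ 4⟯ B) (hττ : ∀ x, τ (τ x) = x) (hh₂ : ∀ j, h₂ j = (q₂ j).transport τ) :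
    (∀ a'' : ↥(coresComplement h₂), (τ a'' : B) ∈ coresComplement q₂) ∧
      (∀ a' : ↥(coresComplement q₂), (τ a' : B) ∈ coresComplement h₂) := by
  have hfun : h₂ = fun j => (q₂ j).transport τ := funext hh₂
  subst hfun
  have hsymm : ∀ x, τ.symm x = τ x := fun x => by
    have h1 := hττ (τ.symm x)
    rw [Diffeomorph.apply_symm_apply] at h1
    exact h1.symm
  refine ⟨fun a'' => ?_, fun a' => ?_⟩
  · have := (mem_coresComplement_transport_iff q₂ τ).1 a''.2
    rwa [hsymm] at this
  · exact (mem_coresComplement_transport_iff q₂ τ).2 (by rw [hsymm, hττ]; exact a'.2)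

end Glue

/-! ### §2 Registered helper -/

/-- **Sub-goal `helper_lamSq_le_of_dualMap_apply_eq_incl` of stub `stub_T3_dualPresentation`** (T3
assembly glue; wave 5, lead c5): the tube computation behind the seam clause
(`lamSq_le_of_dualMap_apply_eq_incl`, fully qualified registered text). [cite: Kosinski1993, VI §6] -/
theorem helper_lamSq_le_of_dualMap_apply_eq_incl : ∀ {B : Type} [TopologicalSpace B] [T2Space B] [ChartedSpace (EuclideanHalfSpace 4) B] {ι : Type} [Finite ι] {h : ι → Literature.Topology.FourManifolds.HandleAttachingMap 3 2 B} {X : Type} [TopologicalSpace X] [ChartedSpace (EuclideanHalfSpace 4) X] [IsManifold (𝓡∂ 4) ∞ X] {W : Type} [TopologicalSpace W] [ChartedSpace (EuclideanHalfSpace 4) W] [IsManifold (𝓡∂ 4) ∞ W] (D : Literature.Topology.FourManifolds.HandleAttachingMap.MultiAttachmentData h (𝓡∂ 4) X) (bX : Literature.Topology.FourManifolds.BoundaryData (𝓡∂ 4) X (𝓡 3)) (bW : Literature.Topology.FourManifolds.BoundaryData (𝓡∂ 4) W (𝓡 3)) (Ψ : bX.carrier ≃ₘ⟮𝓡 3,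 𝓡 3⟯ bW.carrier) (col : (Literature.Topology.FourManifolds.BoundaryManifold.boundaryData 3 W).Collar) (κ δ : ℝ) (hκ : 0 < κ) (hκ1 : κ ≤ 1) (hδ : 0 < δ) (hδ2 : δ ≤ 1 / 2) (j : ι) (y : ↥(Literature.Topology.FourManifolds.handleTube 3 2)) (z : bX.carrier) (a : ↥(Literature.Topology.FourManifolds.HandleAttachingMap.coresComplement h)), D.jA a = bX.incl z → (∀ t : ↥(Literature.Topology.FourManifolds.handleTube 3 2), (h j).toFun t = (a : B) → ‖Literature.Topology.FourManifolds.lamPart ((t : Metric.closedBall (0 : EuclideanSpace ℝ (Fin 4)) 1) : EuclideanSpace ℝ (Fin 4))‖ ^ 2 ≤ 1 - 3 * κ ^ 2 / 4) → (Summit.SmoothPoincare4.SmoothPoincare4.Theorems.AcyclicBisectionExists.ModpBraidOrbits.dualMap D bX bW Ψ col κ δ hκ hκ1 hδ hδ2 j).toFun y = bW.incl (Ψ z) → Literature.Topology.FourManifolds.lamSq 2 ((y : Metric.closedBall (0 : EuclideanSpace ℝ (Fin 4)) 1) : EuclideanSpace ℝ (Fin 4)) ≤ 1 / 4 :=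
  fun D bX bW Ψ col κ δ hκ hκ1 hδ hδ2 j y z a hz hsh heq =>
    lamSq_le_of_dualMap_apply_eq_incl D bX bW Ψ col κ δ hκ hκ1 hδ hδ2 j y z a hz hsh heq

end Summit.SmoothPoincare4.SmoothPoincare4.Theorems.AcyclicBisectionExists.ModpBraidOrbits

end
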